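import Summits.QuantumFields.BalabanUV.T4Continuum.Spine.NE2BalabanThreshold

/-!
# T⁴ programme, spine node NE2 (U1a), tier B row B7 (ASSEMBLY) — ROOT B THROUGH EVERY STATION ON ROW DATA: named limit with rate `L^{−k}`,
# NE2-LIP and holomorphy in the coupling `t` for BAŁABAN's TYPED TIER-B OPERATOR, the Neumann disc containing the closed unit disc under `η ≤ η⋆`

NE2 formalisation swarm `b2b-balaban-t4-ne2-formalise-*`, leaf prover 08 (gen 2; row B7 of `t4/formal/NE2/LEAVES.md`), PART 2 file 8.  Row B7's
deliverable (skeleton `t4/SKELETON-NE2-P1.md` §2B, LEAVES row B7) lists, besides ROOT B's `TowerLimitRate` at `t = 1` (`NE2BalabanFinal` /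
`NE2BalabanThreshold`), the STATIONS of the resolvent route «by name as ROOT A, lifted by `⊗ₖ 1`»: the NAMED LIMIT `pertLimC`, the rate, NE2-LIP
(`‖Λ(t) − Λ(0)‖ ≤ ‖t‖κ·Cst·(1 − ‖t‖κ)⁻¹`) and HOLOMORPHY on the Neumann disc.  `NE2BalabanRoot.balaban_root` gives them with the B3/B4 laws as
binders (`hE`, `hP₄`); THIS FILE gives them ON ROW DATA ONLY — `hpert := NE2BalabanFinal.perturbationLaws_balaban_final` fed to PART 1's
`NE2ColourPerturbedLayer.ne2Plus_resolvent_route_kron`: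
 * **`balaban_final_stations`**: binders `hreg` (row B5's class), `hNE3` (node NE3 BY NAME, OPEN), `0 < a′`, the two B4 numeric thresholds
   `kappaS … < 1`, `σ₀⁻²·δK < 1`, and a coupling `t` in the Neumann disc `‖t‖·κ_B < 1` (`κ_B = kappaBs o d a α β (a·(epsR·(2+epsR)·Cst)) (kappa4F …)`)
   ⟹ `Tendsto (pertCovC P t) atTop (𝓝 (pertLimC P t))` ∧ (the same at `t = 0`) ∧ rate `Cpert(t)·L^{−k}/(1 − L⁻¹)` ∧ NE2-LIP ∧
   `DifferentiableOn ℂ (pertLimC P) {t | ‖t‖κ_B < 1}`, `P = balabanPert (liftR Rg) (gaugeSlot Rg (QuT (siteT Rg)) Q1 a′)`;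
 * **`norm_mul_kappaBs_lt_one_of_regular`**: under `α, β ≤ η ≤ etaStar o d a a′` the Neumann disc contains the CLOSED UNIT DISC (`‖t‖ ≤ 1 ⇒ ‖t‖κ_B < 1`);
 * **`balaban_final_stations_of_regular`**: the stations for every `‖t‖ ≤ 1` displaying ONLY `hreg`, `hNE3`, `0 < a′`, `α ≤ η`, `β ≤ η`, `η ≤ η⋆`, and
   **`differentiableOn_balaban_final_unitBall`**: holomorphy of `t ↦ pertLimC P t` on the closed unit disc — the physical coupling `t = 1` is an
   interior point of the holomorphy domain (the disc is open and strictly larger).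

HONEST FRAMING (T4-DAG p. 1).  Composition BY NAME (PART 1's stations ∘ file 6's law ∘ file 7's arithmetic); `Rg`, `a′` DATA; hypothesis SHAPES; no
assertion that `Rg` is Bałaban's minimiser (no B0, c5); GLOBAL small field; finite torus, linear layer, operator norm; ROOT B CONDITIONAL on node NE3
(OPEN); NOT [B9] (3.23)–(3.26) as printed; NE2 (U1a) is NOT PROVED by this file (c1 with the carver); spine PROVED count 0/9 unchanged; NOT infinite
volume / mass gap / Clay.  HONEST DEPENDENCY: continuum YM on T⁴ ⇐ BetaPertH ∧ nine spine estimates (0/9 proved); BetaPertH ⇐ (D1) ∧ (D4) ∧ CAP+tail;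
G-an2-4 gates asym, D1 and NE2/3/4.  ABSOLUTE RULE: no internally-minted statement enters as a cited fact; no `def … : Prop` fact; no new
definition; no `sorry`.
-/

noncomputable section

open scoped BigOperators ComplexConjugate Matrix Matrix.Norms.L2Operator Kronecker
open Filter Topology

namespace Summit.QuantumFields.BalabanUV.T4Continuum.NE2BalabanStations

open Literature.MathematicalPhysics.QuantumFieldTheory.Balaban1983to89.B5Prop11Plancherel (Cst Cst_nonneg Tor fine)
open Literature.MathematicalPhysics.QuantumFieldTheory.Balaban1983to89.B5G183RateUnitTower (lev lev_neZero)
open Literature.MathematicalPhysics.QuantumFieldTheory.Balaban1983to89.T4EtaRateMin (LocalRate)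
open Summit.QuantumFields.BalabanUV.T4Continuum
open Summit.QuantumFields.BalabanUV.T4Continuum.BalabanAveragedTowerUnit (idx Qlev)
open Summit.QuantumFields.BalabanUV.T4Continuum.BackgroundResolventTower
open Summit.QuantumFields.BalabanUV.T4Continuum.KingPairingPlantedLaw
open Summit.QuantumFields.BalabanUV.T4Continuum.GramPerturbationLaw (C2gram)
open Summit.QuantumFields.BalabanUV.T4Continuum.NE2FromNE3 (bgReadings)
open Summit.QuantumFields.BalabanUV.T4Continuum.NE2ColourPerturbedLayer (pertCovC pertLimC ne2Plus_resolvent_route_kron)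
open Summit.QuantumFields.BalabanUV.T4Continuum.CovariantAveragingSummand (kappaQ kappaQ_ofReal)
open Summit.QuantumFields.BalabanUV.T4Continuum.RegularBackgroundTower (RegularTransporters regClass betaNE3)
open Summit.QuantumFields.BalabanUV.T4Continuum.GaugeTermPerturbationLaw (deltaK)
open Summit.QuantumFields.BalabanUV.T4Continuum.GaugeTermScalarData (QuT Q1)
open Summit.QuantumFields.BalabanUV.T4Continuum.GaugeTermInstanceGeom (gS)
open Summit.QuantumFields.BalabanUV.T4Continuum.ScalarAveragedCompression (sigma0)
open Summit.QuantumFields.BalabanUV.T4Continuum.ScalarCovariantLaplacian (kappaS)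
open Summit.QuantumFields.BalabanUV.T4Continuum.RegularSiteTransporters (siteT)
open Summit.QuantumFields.BalabanUV.T4Continuum.NestedContourTransport (theta0)
open Summit.QuantumFields.BalabanUV.T4Continuum.NE2BalabanRoot (balabanPert)
open Summit.QuantumFields.BalabanUV.T4Continuum.NE2BalabanGauge (gaugeSlot liftR)
open Summit.QuantumFields.BalabanUV.T4Continuum.NE2BalabanLayerSharp (kappaBs C2Bs KstarR kappaBs_balaban_le_of_small)
open Summit.QuantumFields.BalabanUV.T4Continuum.NE2BalabanWiring (epsR CdeltaR epsR_nonneg)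
open Summit.QuantumFields.BalabanUV.T4Continuum.NE2BalabanFinal (tauR kappa4F C4F perturbationLaws_balaban_final)
open Summit.QuantumFields.BalabanUV.T4Continuum.NE2BalabanThreshold (Kmax etaStar smallness_of_le)

variable {d : ℕ} (L : ℕ) [NeZero L] (M : Fin d → ℕ) [hM : ∀ μ, NeZero (M μ)] (a : ℝ) (ha : 0 < a)
variable {o : Type*} [Fintype o] [DecidableEq o]

/-! ## §1 The stations on row data, on the Neumann disc -/

/-- **ROW B7 — ROOT B THROUGH EVERY STATION ON ROW DATA** (`L ≥ 2`, `d ≥ 1`): for site-based bond transporters `Rg` in row B5's (3.35)-shape class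
whose coefficient towers `{w, Dw}` obey NODE NE3's `LocalRate … C L⁻¹` (BY NAME, OPEN), mass `a′ > 0`, the B4 thresholds `kappaS … < 1`,
`σ₀⁻²·δK < 1`, and every coupling `t` in the Neumann disc `‖t‖·κ_B < 1`: the lifted King-averaged unit-lattice covariances `pertCovC P t k` of
`(Δ_a^{(k)} ⊗ 1 + t·P_k)⁻¹`, `P = balabanPert (liftR Rg) (gaugeSlot …)` the typed tier-B perturbation, CONVERGE to the NAMED LIMIT `pertLimC P t` (and at
`t = 0` to the free limit), with RATE `Cpert(t)·L^{−k}/(1 − L⁻¹)`, the limit is NE2-LIP in `t` (`‖Λ(t) − Λ(0)‖ ≤ ‖t‖κ_B·Cst·(1 − ‖t‖κ_B)⁻¹`) and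
HOLOMORPHIC on the disc — PART 1's `ne2Plus_resolvent_route_kron` with `hpert := perturbationLaws_balaban_final`.  Model level (no B0); NE2 (U1a) is NOT
proved by this. [cite: Balaban1985BackgroundPropagators, (3.26) p.395 (shape)] [folklore] -/
theorem balaban_final_stations (hL : 2 ≤ L) (hd : 1 ≤ d) {Rg : (k : ℕ) → Fin d → (Tor (fine (lev L k) M) → Matrix o o ℂ)}
    {α β : ℝ} (hreg : RegularTransporters L M (liftR L M Rg) α β) {C : ℝ} (hC : 0 ≤ C)
    (hNE3 : LocalRate (bgReadings L M (regClass L M (liftR L M Rg))) C ((L : ℝ)⁻¹)) {a' : ℝ} (ha' : 0 < a')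
    (hκ : kappaS d a' α β (tauR d α) < 1)
    (hsmall : ((sigma0 d a') ^ 2)⁻¹ * deltaK (gS d a' (kappaS d a' α β (tauR d α))) (1 + tauR d α) (d * α) (tauR d α) a' < 1)
    {t : ℂ} (ht : ‖t‖ * kappaBs o d a α β (a * (epsR o d α * (2 + epsR o d α) * Cst d a)) (kappa4F d a a' α β) < 1) :
    Tendsto (pertCovC L M a ha (balabanPert L M a (liftR L M Rg) (gaugeSlot L M Rg (QuT L M o (siteT L M Rg)) (Q1 L M o) a')) t) atTop
        (𝓝 (pertLimC L M a ha (balabanPert L M a (liftR L M Rg) (gaugeSlot L M Rg (QuT L M o (siteT L M Rg)) (Q1 L M o) a')) t)) ∧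
      Tendsto (pertCovC L M a ha (balabanPert L M a (liftR L M Rg) (gaugeSlot L M Rg (QuT L M o (siteT L M Rg)) (Q1 L M o) a')) 0) atTop
        (𝓝 (pertLimC L M a ha (balabanPert L M a (liftR L M Rg) (gaugeSlot L M Rg (QuT L M o (siteT L M Rg)) (Q1 L M o) a')) 0)) ∧
      (∀ k, ‖pertCovC L M a ha (balabanPert L M a (liftR L M Rg) (gaugeSlot L M Rg (QuT L M o (siteT L M Rg)) (Q1 L M o) a')) t k
            - pertLimC L M a ha (balabanPert L M a (liftR L M Rg) (gaugeSlot L M Rg (QuT L M o (siteT L M Rg)) (Q1 L M o) a')) t‖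
          ≤ Cpert (kappaBs o d a α β (a * (epsR o d α * (2 + epsR o d α) * Cst d a)) (kappa4F d a a' α β)) (2 * d * Cst d a) (CJ d a)
              (C2Bs o d L a α β C
                (a * C2gram (Cst d a) 1 (epsR o d α) (2 * d * Cst d a) (CJ d a) (Cst d a) (CdeltaR o d a α (theta0 d α (betaNE3 o C))))
                (C4F o d L a a' α β C)) 0 t * ((L : ℝ)⁻¹) ^ k / (1 - (L : ℝ)⁻¹)) ∧
      ‖pertLimC L M a ha (balabanPert L M a (liftR L M Rg) (gaugeSlot L M Rg (QuT L M o (siteT L M Rg)) (Q1 L M o) a')) t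
          - pertLimC L M a ha (balabanPert L M a (liftR L M Rg) (gaugeSlot L M Rg (QuT L M o (siteT L M Rg)) (Q1 L M o) a')) 0‖
        ≤ ‖t‖ * kappaBs o d a α β (a * (epsR o d α * (2 + epsR o d α) * Cst d a)) (kappa4F d a a' α β) * Cst d a
          * (1 - ‖t‖ * kappaBs o d a α β (a * (epsR o d α * (2 + epsR o d α) * Cst d a)) (kappa4F d a a' α β))⁻¹ ∧
      DifferentiableOn ℂ (pertLimC L M a ha (balabanPert L M a (liftR L M Rg) (gaugeSlot L M Rg (QuT L M o (siteT L M Rg)) (Q1 L M o) a')))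
        {t : ℂ | ‖t‖ * kappaBs o d a α β (a * (epsR o d α * (2 + epsR o d α) * Cst d a)) (kappa4F d a a' α β) < 1} := by
  have h := perturbationLaws_balaban_final L M a ha hd hreg hC hNE3 ha' hκ hsmall
  rw [kappaQ_ofReal ha.le] at h
  exact ne2Plus_resolvent_route_kron L M a ha hL h ht

/-! ## §2 Under the explicit threshold the Neumann disc contains the closed unit disc -/

omit [NeZero L] hM [DecidableEq o] in
/-- **`‖t‖ ≤ 1 ⟹ ‖t‖·κ_B < 1` UNDER `α, β ≤ η ≤ η⋆`**: the Neumann disc of `balabanPert` contains the CLOSED unit disc (file 7's `smallness_of_le` +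
leaf-03's `kappaBs_balaban_le_of_small`: `κ_B ≤ η·Kmax·KstarR < 1`). [folklore] -/
theorem norm_mul_kappaBs_lt_one_of_regular (ha0 : 0 ≤ a) {a' α β η : ℝ} (ha' : 0 < a') (hα : 0 ≤ α) (hβ : 0 ≤ β) (hαη : α ≤ η) (hβη : β ≤ η)
    (hη : η ≤ etaStar o d a a') {t : ℂ} (ht : ‖t‖ ≤ 1) :
    ‖t‖ * kappaBs o d a α β (a * (epsR o d α * (2 + epsR o d α) * Cst d a)) (kappa4F d a a' α β) < 1 := by
  obtain ⟨-, -, h3, h4, h5, h6, h7, h8⟩ := smallness_of_le (o := o) (d := d) a ha0 ha' hα hβ hαη hβη hη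
  have hκ := kappaBs_balaban_le_of_small (o := o) (d := d) a ha0 hα (epsR_nonneg (o := o) (d := d) hα) h3 h4 h5 h6 h7
  set κ := kappaBs o d a α β (a * (epsR o d α * (2 + epsR o d α) * Cst d a)) (kappa4F d a a' α β) with hκdef
  rcases le_or_gt κ 0 with hneg | hpos
  · exact (mul_nonpos_of_nonneg_of_nonpos (norm_nonneg t) hneg).trans_lt zero_lt_one
  · calc ‖t‖ * κ ≤ 1 * κ := mul_le_mul_of_nonneg_right ht hpos.le
      _ ≤ η * Kmax o d a a' * KstarR o d a := by rw [one_mul]; exact hκ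
      _ < 1 := h8

/-! ## §3 The stations for every coupling in the closed unit disc, displaying only the class, node NE3 and `η ≤ η⋆` -/

/-- **ROW B7 — THE STATIONS UNDER THE ONE EXPLICIT THRESHOLD, FOR EVERY `‖t‖ ≤ 1`** (`L ≥ 2`, `d ≥ 1`, `a′ > 0`): displayed binders ONLY `hreg`
(row B5's (3.35)-shape class), `hNE3` (node NE3 BY NAME, OPEN), `0 < a′`, `α ≤ η`, `β ≤ η`, `η ≤ etaStar o d a a′`, `‖t‖ ≤ 1` ⟹ named limit, limit at
`t = 0`, rate, NE2-LIP and holomorphy on the Neumann disc for Bałaban's typed tier-B operator — §1 with the B4 thresholds from `smallness_of_le` and the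
disc membership from §2.  In particular the physical coupling `t = 1` is covered.  Model level (no B0); NE2 (U1a) is NOT proved by this. [folklore] -/
theorem balaban_final_stations_of_regular (hL : 2 ≤ L) (hd : 1 ≤ d) {Rg : (k : ℕ) → Fin d → (Tor (fine (lev L k) M) → Matrix o o ℂ)}
    {α β : ℝ} (hreg : RegularTransporters L M (liftR L M Rg) α β) {C : ℝ} (hC : 0 ≤ C)
    (hNE3 : LocalRate (bgReadings L M (regClass L M (liftR L M Rg))) C ((L : ℝ)⁻¹)) {a' : ℝ} (ha' : 0 < a')
    {η : ℝ} (hαη : α ≤ η) (hβη : β ≤ η) (hη : η ≤ etaStar o d a a') {t : ℂ} (ht : ‖t‖ ≤ 1) :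
    Tendsto (pertCovC L M a ha (balabanPert L M a (liftR L M Rg) (gaugeSlot L M Rg (QuT L M o (siteT L M Rg)) (Q1 L M o) a')) t) atTop
        (𝓝 (pertLimC L M a ha (balabanPert L M a (liftR L M Rg) (gaugeSlot L M Rg (QuT L M o (siteT L M Rg)) (Q1 L M o) a')) t)) ∧
      Tendsto (pertCovC L M a ha (balabanPert L M a (liftR L M Rg) (gaugeSlot L M Rg (QuT L M o (siteT L M Rg)) (Q1 L M o) a')) 0) atTop
        (𝓝 (pertLimC L M a ha (balabanPert L M a (liftR L M Rg) (gaugeSlot L M Rg (QuT L M o (siteT L M Rg)) (Q1 L M o) a')) 0)) ∧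
      (∀ k, ‖pertCovC L M a ha (balabanPert L M a (liftR L M Rg) (gaugeSlot L M Rg (QuT L M o (siteT L M Rg)) (Q1 L M o) a')) t k
            - pertLimC L M a ha (balabanPert L M a (liftR L M Rg) (gaugeSlot L M Rg (QuT L M o (siteT L M Rg)) (Q1 L M o) a')) t‖
          ≤ Cpert (kappaBs o d a α β (a * (epsR o d α * (2 + epsR o d α) * Cst d a)) (kappa4F d a a' α β)) (2 * d * Cst d a) (CJ d a)
              (C2Bs o d L a α β C
                (a * C2gram (Cst d a) 1 (epsR o d α) (2 * d * Cst d a) (CJ d a) (Cst d a) (CdeltaR o d a α (theta0 d α (betaNE3 o C))))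
                (C4F o d L a a' α β C)) 0 t * ((L : ℝ)⁻¹) ^ k / (1 - (L : ℝ)⁻¹)) ∧
      ‖pertLimC L M a ha (balabanPert L M a (liftR L M Rg) (gaugeSlot L M Rg (QuT L M o (siteT L M Rg)) (Q1 L M o) a')) t
          - pertLimC L M a ha (balabanPert L M a (liftR L M Rg) (gaugeSlot L M Rg (QuT L M o (siteT L M Rg)) (Q1 L M o) a')) 0‖
        ≤ ‖t‖ * kappaBs o d a α β (a * (epsR o d α * (2 + epsR o d α) * Cst d a)) (kappa4F d a a' α β) * Cst d a
          * (1 - ‖t‖ * kappaBs o d a α β (a * (epsR o d α * (2 + epsR o d α) * Cst d a)) (kappa4F d a a' α β))⁻¹ ∧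
      DifferentiableOn ℂ (pertLimC L M a ha (balabanPert L M a (liftR L M Rg) (gaugeSlot L M Rg (QuT L M o (siteT L M Rg)) (Q1 L M o) a')))
        {t : ℂ | ‖t‖ * kappaBs o d a α β (a * (epsR o d α * (2 + epsR o d α) * Cst d a)) (kappa4F d a a' α β) < 1} := by
  obtain ⟨h1, h2, -, -, -, -, -, -⟩ := smallness_of_le (o := o) (d := d) a ha.le ha' hreg.nonneg.1 hreg.nonneg.2 hαη hβη hη
  exact balaban_final_stations L M a ha hL hd hreg hC hNE3 ha' h1 h2
    (norm_mul_kappaBs_lt_one_of_regular (o := o) (d := d) a ha.le ha' hreg.nonneg.1 hreg.nonneg.2 hαη hβη hη ht)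

/-- **HOLOMORPHY OF THE LIMIT ON THE CLOSED UNIT DISC** under `α, β ≤ η ≤ η⋆`: `t ↦ pertLimC P t` is complex-differentiable on a neighbourhood of
every `‖t‖ ≤ 1` (the Neumann disc is open and contains the closed unit disc) — the physical coupling `t = 1` is an interior point of the holomorphy
domain.  Model level; NE2 NOT proved by this. [folklore] -/
theorem differentiableOn_balaban_final_unitBall (hL : 2 ≤ L) (hd : 1 ≤ d) {Rg : (k : ℕ) → Fin d → (Tor (fine (lev L k) M) → Matrix o o ℂ)}
    {α β : ℝ} (hreg : RegularTransporters L M (liftR L M Rg) α β) {C : ℝ} (hC : 0 ≤ C)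
    (hNE3 : LocalRate (bgReadings L M (regClass L M (liftR L M Rg))) C ((L : ℝ)⁻¹)) {a' : ℝ} (ha' : 0 < a')
    {η : ℝ} (hαη : α ≤ η) (hβη : β ≤ η) (hη : η ≤ etaStar o d a a') :
    DifferentiableOn ℂ (pertLimC L M a ha (balabanPert L M a (liftR L M Rg) (gaugeSlot L M Rg (QuT L M o (siteT L M Rg)) (Q1 L M o) a')))
      {t : ℂ | ‖t‖ ≤ 1} := by
  have h1 : ‖(1 : ℂ)‖ ≤ 1 := by rw [norm_one]
  obtain ⟨-, -, -, -, hD⟩ := balaban_final_stations_of_regular L M a ha hL hd hreg hC hNE3 ha' hαη hβη hη h1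
  exact hD.mono fun t ht => norm_mul_kappaBs_lt_one_of_regular (o := o) (d := d) a ha.le ha' hreg.nonneg.1 hreg.nonneg.2 hαη hβη hη ht

end Summit.QuantumFields.BalabanUV.T4Continuum.NE2BalabanStations

end
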